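import Summits.BirchSwinnertonDyer.Rank1Residual.X11b.ZpLineIndexExact
import Summits.BirchSwinnertonDyer.Rank1Residual.X11b.BDPRouteRankOneBookkeeping
import HarnessLib

/-!
# Crux `AnticycControlAdditiveK` (route `SchneiderFreeAdditiveX3`, item stmt-BirchSwinnertonDyer-19295),
# stub `stub_baseCountTors` (P6-add-tors) on regime B2 (`E(K)[p] ≠ 0`) — part 3: the three RANK-ONE
# INDICES of the exact base count WITH rational `p`-torsion — part 3a: the GLOBAL ones (pure algebra)

Seat `bsd-schneider-door-c6`, gen 2 (cell `bsd-schneider-ideate`). The exact base Selmer count (JSW17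
Prop. 3.2.1 `=`, c4-g2's `natCard_selmerAcBase_mul_eq_of_rankOne_anyReduction`) reads three indices of the
rank-one group `A = E(K)` (coordinate `c : A → ℤ`, `c Q = 1`, `ker c` = the finite torsion `T`) under
`A[p] = 0`: `[A : p^k A] = p^k`, `ord_p [A : ℤP] = ord_p|c P|`, and in `G = E(ℚ_p) ⊇ E ≅ ℤ_p`
(`Ψ(G) = p^m ℤ_p`, `p^m = #G[p^∞]`, `e = v(Ψ fQ)`) `[G : p^k G + f(A)] = p^e`. With `p`-torsion:
* §1 `natCard_mul_natCard_primaryComponent_eq` — in a finite abelian group `B`, a subgroup `C ⊇ p^m B`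
  WITHOUT `p`-torsion (`p^m` killing `B[p^∞]`) has `#C · #B[p^∞] = #B`;
* §2 **`index_range_zsmul_pow_eq_mul`** `[A : p^k A] = p^k · #A[p^∞]`; **`padicValNat_index_zmultiples_eq_add`**
  `ord_p [A : ℤP] = ord_p |c P| + ord_p #T` (`[A : ℤP] = |c P| · #T`); `p^{ord_p #T} = #A[p^∞]`;
* part 3b (`…LocalIndexAnyTorsion.lean`): `[G : p^k G + f(A)] · #A[p^∞] = p^e` (`k ≥ e`).
So `#Sel⁽ᵖᵏ⁾ = p^{k+g}·#Ш[p^k]` and JSW's `#δ_𝔮 = p^{e−g}` (`p^g = #E(K)[p^∞]`): the `g`'s CANCEL in the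
level count (part 1). Theorems only; no `Prop` fact; closes nothing by itself; BSD is not proved by this.
References: [JetchevSkinnerWan2017] Prop. 3.2.1, (7.1.5) (arXiv:1512.06894 pp. 10–11, 16); [Castella2018]
Thm. 2.3 (calcul) (arXiv:1704.06608 p. 6); [SilvermanAEC2009] VII.6.3, VIII.6.
-/

noncomputable section

open scoped Classical

set_option linter.dupNamespace false

namespace Summit.BirchSwinnertonDyer.BirchSwinnertonDyer.Theorems.SchneiderFreeAdditiveX3

open Summit.BirchSwinnertonDyer.Rank1Residual.X11b

/-! ## §1. Counting in a finite abelian group: a `p`-torsion-free subgroup containing `p^m B` -/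

section PrimaryCounting

variable {B : Type*} [AddCommGroup B] (p : ℕ) [Fact p.Prime]

omit [Fact p.Prime] in
/-- In a subgroup without `p`-torsion there is no `p^n`-torsion. [folklore] -/
theorem eq_zero_of_pow_nsmul_eq_zero_of_mem (C : AddSubgroup B) (hC : ∀ c ∈ C, p • c = 0 → c = 0)
    (n : ℕ) {c : B} (hc : c ∈ C) (h : p ^ n • c = 0) : c = 0 := by
  induction n generalizing c with
  | zero => simpa using h
  | succ n ih =>
    rw [pow_succ, mul_smul] at h
    exact hC c hc (ih (C.nsmul_mem hc p) h)

omit [Fact p.Prime] in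
/-- `#H · [H : K-relative] = #K` for `H ≤ K`. [folklore] -/
theorem natCard_mul_relIndex_of_le {H K : AddSubgroup B} (h : H ≤ K) :
    Nat.card H * H.relIndex K = Nat.card K := by
  rw [AddSubgroup.relIndex, ← Nat.card_congr (AddSubgroup.addSubgroupOfEquivOfLe h).toEquiv]
  exact AddSubgroup.card_mul_index _

omit [Fact p.Prime] in
/-- **`#C · #B[p^∞] = #B`** for a finite abelian `B`, `C ⊇ p^m B` without `p`-torsion, `p^m · B[p^∞] = 0`:
`p^m B ≤ C` has order `#B/#B[p^m] = #B/#B[p^∞]`, and `C ⊕ B[p^∞] ↪ B`. [folklore] -/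
theorem natCard_mul_natCard_primaryComponent_eq [Finite B] (m : ℕ) (C : AddSubgroup B)
    (hC : ∀ c ∈ C, p • c = 0 → c = 0)
    (hm : ∀ b ∈ AddCommGroup.primaryComponent B p, p ^ m • b = 0)
    (hmC : ∀ b : B, p ^ m • b ∈ C) :
    Nat.card C * Nat.card (AddCommGroup.primaryComponent B p) = Nat.card B := by
  set P := AddCommGroup.primaryComponent B p with hP
  set ψ : B →+ B := nsmulAddMonoidHom (p ^ m) with hψ
  have hker : ψ.ker = P := by
    ext b
    rw [AddMonoidHom.mem_ker, hψ, nsmulAddMonoidHom_apply]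
    exact ⟨fun h ↦ (AddCommGroup.mem_primaryComponent).mpr ⟨m, h⟩, fun h ↦ hm b h⟩
  have hrange : ψ.range ≤ C := by
    rintro _ ⟨b, rfl⟩
    exact hmC b
  -- `#range ψ · #ker ψ = #B`
  have h1 : Nat.card ψ.range * Nat.card ψ.ker = Nat.card B := by
    rw [← Nat.card_congr (QuotientAddGroup.quotientKerEquivRange ψ).toEquiv]
    exact (AddSubgroup.card_eq_card_quotient_mul_card_addSubgroup ψ.ker).symm
  have hle1 : Nat.card B ≤ Nat.card C * Nat.card P := by
    rw [← h1, hker]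
    exact Nat.mul_le_mul_right _
      (Nat.card_le_card_of_injective _ (AddSubgroup.inclusion_injective hrange))
  -- `C ⊓ P = ⊥`, so `#(C ⊔ P) = #C · #P ∣ #B`
  have hdisj : C ⊓ P = ⊥ := by
    rw [eq_bot_iff]
    rintro c ⟨hcC, hcP⟩
    obtain ⟨n, hn⟩ := (AddCommGroup.mem_primaryComponent).mp hcP
    exact (AddSubgroup.mem_bot).mpr (eq_zero_of_pow_nsmul_eq_zero_of_mem p C hC n hcC hn)
  have h2 : Nat.card ↥(C ⊔ P) = Nat.card C * Nat.card P := by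
    rw [← natCard_mul_relIndex_of_le (le_sup_left : C ≤ C ⊔ P), AddSubgroup.relIndex_sup_left,
      ← AddSubgroup.inf_relIndex_right, hdisj, AddSubgroup.relIndex_bot_left]
  have hle2 : Nat.card C * Nat.card P ≤ Nat.card B := by
    rw [← h2]
    exact Nat.le_of_dvd Nat.card_pos (AddSubgroup.card_addSubgroup_dvd_card _)
  exact le_antisymm hle2 hle1

end PrimaryCounting

/-! ## §2. The global rank-one indices with torsion -/

section Global

variable {A : Type*} [AddCommGroup A] {p : ℕ} [Fact p.Prime]
  (c : A →+ ℤ) (Q : A) (hQ : c Q = 1) (hker : ∀ x : A, c x = 0 → IsOfFinAddOrder x)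

include hQ hker in
/-- **`[A : p^k A] = p^k · #A[p^∞]`** for a "rank-one" abelian group (`c Q = 1`, `ker c` = finite
torsion `T`) and `p^k · A[p^∞] = 0`: `x ↦ c(x) mod p^k` is onto with kernel `p^k A + T`, and
`[p^k A + T : p^k A] = [T : p^k T] = #T[p^k] = #A[p^∞]` (torsion-free case: `RankOne.index_range_zsmul_pow_eq`).
[cite: JetchevSkinnerWan2017, Prop. 3.2.1 (proof, arXiv:1512.06894 p. 10), `E(K)/p^k E(K)` for rank one] -/
theorem index_range_zsmul_pow_eq_mul [Finite (AddCommGroup.torsion A)] (k : ℕ)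
    (hk : ∀ a ∈ AddCommGroup.primaryComponent A p, p ^ k • a = 0) :
    ((zsmulAddGroupHom ((p ^ k : ℕ) : ℤ) : A →+ A).range).index =
      p ^ k * Nat.card (AddCommGroup.primaryComponent A p) := by
  haveI : NeZero (p ^ k) := ⟨pow_ne_zero _ (Fact.out : p.Prime).ne_zero⟩
  set R := (zsmulAddGroupHom ((p ^ k : ℕ) : ℤ) : A →+ A).range with hR
  set T := AddCommGroup.torsion A with hT
  set f : A →+ ZMod (p ^ k) := (Int.castAddHom (ZMod (p ^ k))).comp c with hf
  have hfs : Function.Surjective f :=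
    (ZMod.intCast_surjective (n := p ^ k)).comp (RankOne.coord_surjective c Q hQ)
  -- `ker f = R ⊔ T`
  have hfker : f.ker = R ⊔ T := by
    apply le_antisymm
    · intro x hx
      rw [AddMonoidHom.mem_ker] at hx
      change ((c x : ℤ) : ZMod (p ^ k)) = 0 at hx
      rw [ZMod.intCast_zmod_eq_zero_iff_dvd] at hx
      obtain ⟨a, ha⟩ := hx
      have ht : x - c x • Q ∈ T :=
        (AddCommGroup.mem_torsion _).mpr (RankOne.isOfFinAddOrder_sub_coord_zsmul c Q hQ hker x)
      have hx' : x = ((p ^ k : ℕ) : ℤ) • (a • Q) + (x - c x • Q) := by rw [ha, smul_smul]; abel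
      rw [hx']
      exact AddSubgroup.add_mem _ (AddSubgroup.mem_sup_left ⟨a • Q, rfl⟩)
        (AddSubgroup.mem_sup_right ht)
    · refine sup_le ?_ ?_
      · rintro _ ⟨y, rfl⟩
        rw [AddMonoidHom.mem_ker, zsmulAddGroupHom_apply, map_zsmul, natCast_zsmul, nsmul_eq_mul,
          ZMod.natCast_self, zero_mul]
      · intro t ht
        rw [AddMonoidHom.mem_ker]
        change ((c t : ℤ) : ZMod (p ^ k)) = 0
        rw [RankOne.coord_eq_zero_of_isOfFinAddOrder c ((AddCommGroup.mem_torsion _).mp ht),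
          Int.cast_zero]
  have hfi : f.ker.index = p ^ k := by
    rw [AddSubgroup.index_ker, AddMonoidHom.range_eq_top.mpr hfs, AddSubgroup.card_top, Nat.card_zmod]
  -- `R ⊓ T = p^k T`
  set ψ : T →+ T := (nsmulAddMonoidHom (p ^ k) : T →+ T) with hψ
  have hRT : R.addSubgroupOf T = ψ.range := by
    ext ⟨t, htT⟩
    rw [AddSubgroup.mem_addSubgroupOf]
    change t ∈ R ↔ _
    constructor
    · rintro ⟨a, ha⟩
      rw [zsmulAddGroupHom_apply, natCast_zsmul] at ha
      have haT : a ∈ T := by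
        refine (AddCommGroup.mem_torsion _).mpr (hker a ?_)
        have h := RankOne.coord_eq_zero_of_isOfFinAddOrder c ((AddCommGroup.mem_torsion _).mp htT)
        rw [← ha, map_nsmul, nsmul_eq_mul] at h
        exact (mul_eq_zero.mp h).resolve_left (by exact_mod_cast NeZero.ne (p ^ k))
      exact ⟨⟨a, haT⟩, Subtype.ext ha⟩
    · rintro ⟨a, ha⟩
      refine ⟨(a : A), ?_⟩
      rw [zsmulAddGroupHom_apply, natCast_zsmul]
      have h := congrArg (fun z : T ↦ (z : A)) ha
      simpa only [hψ, nsmulAddMonoidHom_apply, AddSubgroupClass.coe_nsmul] using h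
  -- `[T : p^k T] = #T[p^k] = #A[p^∞]`
  have hψidx : ψ.range.index = Nat.card (AddCommGroup.primaryComponent A p) := by
    rw [AddSubgroup.index_eq_card, TamagawaCoinvariants.natCard_quotient_range_eq_natCard_ker ψ]
    refine Nat.card_congr ⟨fun x ↦ ⟨((x : T) : A), (AddCommGroup.mem_primaryComponent).mpr ⟨k, ?_⟩⟩,
      fun a ↦ ⟨⟨(a : A), ?_⟩, ?_⟩, fun x ↦ rfl, fun a ↦ rfl⟩
    · have hx : ψ (x : T) = 0 := (AddMonoidHom.mem_ker).mp x.2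
      have h := congrArg (fun z : T ↦ (z : A)) hx
      simp only [hψ, nsmulAddMonoidHom_apply, AddSubgroupClass.coe_nsmul, ZeroMemClass.coe_zero] at h
      exact h
    · obtain ⟨n, hn⟩ := (AddCommGroup.mem_primaryComponent).mp a.2
      exact (AddCommGroup.mem_torsion _).mpr (isOfFinAddOrder_iff_nsmul_eq_zero.mpr
        ⟨p ^ n, pow_pos (Fact.out : p.Prime).pos n, hn⟩)
    · rw [AddMonoidHom.mem_ker]
      exact Subtype.ext (hk _ a.2)
  -- assemble: `[A : R] = [A : ker f] · [ker f : R]`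
  have hRle : R ≤ f.ker := by rw [hfker]; exact le_sup_left
  calc R.index = R.relIndex f.ker * f.ker.index := (AddSubgroup.relIndex_mul_index hRle).symm
    _ = p ^ k * Nat.card (AddCommGroup.primaryComponent A p) := by
        rw [hfi, hfker, AddSubgroup.relIndex_sup_left, AddSubgroup.relIndex, hRT, hψidx, mul_comm]

/-- `A[p^∞]` is finite when the torsion of `A` is. [folklore] -/
theorem finite_primaryComponent_of_finite_torsion [Finite (AddCommGroup.torsion A)] :
    Finite (AddCommGroup.primaryComponent A p) := by
  refine Finite.of_injective (fun a : AddCommGroup.primaryComponent A p ↦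
    (⟨(a : A), ?_⟩ : AddCommGroup.torsion A)) fun a b h ↦ ?_
  · obtain ⟨n, hn⟩ := (AddCommGroup.mem_primaryComponent).mp a.2
    exact (AddCommGroup.mem_torsion _).mpr (isOfFinAddOrder_iff_nsmul_eq_zero.mpr
      ⟨p ^ n, pow_pos (Fact.out : p.Prime).pos n, hn⟩)
  · have h' := congrArg (fun x : AddCommGroup.torsion A ↦ (x : A)) h
    dsimp only at h'
    exact Subtype.ext h'

/-- `p^k · A[p^∞] = 0` as soon as `ord_p #A[p^∞] ≤ k` (finite torsion). [folklore] -/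
theorem pow_nsmul_eq_zero_of_padicValNat_le [Finite (AddCommGroup.torsion A)] {k : ℕ}
    (hk : padicValNat p (Nat.card (AddCommGroup.primaryComponent A p)) ≤ k)
    (a : A) (ha : a ∈ AddCommGroup.primaryComponent A p) : p ^ k • a = 0 := by
  haveI := finite_primaryComponent_of_finite_torsion (A := A) (p := p)
  obtain ⟨g, hg⟩ := Literature.NumberTheory.EllipticCurves.exists_card_addPrimaryComponent_eq_pow
    (A := A) p
  rw [hg, padicValNat.prime_pow] at hk
  have h0 : Nat.card (AddCommGroup.primaryComponent A p) •
      (⟨a, ha⟩ : AddCommGroup.primaryComponent A p) = 0 := card_nsmul_eq_zero'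
  rw [hg] at h0
  have h1 : p ^ g • a = 0 := congrArg Subtype.val h0
  rw [← Nat.sub_add_cancel hk, pow_add, mul_smul, h1, smul_zero]

include hQ hker in
/-- **`[A : p^k A] = p^k · #A[p^∞]` for every `k ≥ ord_p #A[p^∞]`** (form consumed by the count).
[cite: JetchevSkinnerWan2017, Prop. 3.2.1 (proof, arXiv:1512.06894 p. 10), `E(K)/p^k E(K)` for rank one] -/
theorem index_range_zsmul_pow_eq_mul_of_le [Finite (AddCommGroup.torsion A)] {k : ℕ}
    (hk : padicValNat p (Nat.card (AddCommGroup.primaryComponent A p)) ≤ k) :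
    ((zsmulAddGroupHom ((p ^ k : ℕ) : ℤ) : A →+ A).range).index =
      p ^ k * Nat.card (AddCommGroup.primaryComponent A p) :=
  index_range_zsmul_pow_eq_mul c Q hQ hker k (pow_nsmul_eq_zero_of_padicValNat_le hk)

include hQ hker in
/-- **`[A : ℤP] = |c P| · #T`** for `P` of infinite order (`c P ≠ 0`): `ℤP + T = c⁻¹(c(P)ℤ)` has index
`|c P|`, and `ℤP ∩ T = 0`. [cite: JetchevSkinnerWan2017, Prop. 3.2.1 and (7.1.5) (arXiv:1512.06894 pp. 10, 16), the index `[E(K):ℤP]`] -/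
theorem index_zmultiples_eq_natAbs_mul_natCard_torsion [Finite (AddCommGroup.torsion A)] (P : A)
    (hP : c P ≠ 0) :
    (AddSubgroup.zmultiples P).index = (c P).natAbs * Nat.card (AddCommGroup.torsion A) := by
  set H := AddSubgroup.zmultiples P with hH
  set T := AddCommGroup.torsion A with hT
  have hsup : H ⊔ T = (AddSubgroup.zmultiples (c P)).comap c := by
    apply le_antisymm
    · refine sup_le ?_ ?_
      · rw [hH, AddSubgroup.zmultiples_le, AddSubgroup.mem_comap]
        exact AddSubgroup.mem_zmultiples _
      · intro t ht
        have hct : c t = 0 :=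
          RankOne.coord_eq_zero_of_isOfFinAddOrder c ((AddCommGroup.mem_torsion _).mp ht)
        rw [AddSubgroup.mem_comap, hct]
        exact AddSubgroup.zero_mem _
    · intro x hx
      rw [AddSubgroup.mem_comap, AddSubgroup.mem_zmultiples_iff] at hx
      obtain ⟨n, hn⟩ := hx
      rw [AddSubgroup.mem_sup]
      refine ⟨n • P, ?_, x - n • P, ?_, add_sub_cancel _ _⟩
      · exact AddSubgroup.zsmul_mem _ (AddSubgroup.mem_zmultiples P) n
      · rw [hT, AddCommGroup.mem_torsion]
        exact hker _ (by rw [map_sub, map_zsmul, hn, sub_self])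
  have hidx : (H ⊔ T).index = (c P).natAbs := by
    rw [hsup, AddSubgroup.index_comap_of_surjective _ (RankOne.coord_surjective c Q hQ),
      Int.index_zmultiples]
  -- `ℤP ∩ T = 0`
  have hinf : H ⊓ T = ⊥ := by
    rw [eq_bot_iff]
    rintro x ⟨hxH, hxT⟩
    obtain ⟨n, rfl⟩ := AddSubgroup.mem_zmultiples_iff.mp hxH
    have h := RankOne.coord_eq_zero_of_isOfFinAddOrder c ((AddCommGroup.mem_torsion _).mp hxT)
    rw [map_zsmul, smul_eq_mul] at h
    rw [(mul_eq_zero.mp h).resolve_right hP, zero_smul]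
    exact AddSubgroup.zero_mem _
  have hrel : H.relIndex (H ⊔ T) * (H ⊔ T).index = H.index :=
    AddSubgroup.relIndex_mul_index le_sup_left
  rw [← hrel, AddSubgroup.relIndex_sup_left, ← AddSubgroup.inf_relIndex_right, hinf,
    AddSubgroup.relIndex_bot_left, hidx, mul_comm]

/-- **`p^{ord_p #T} = #A[p^∞]`** for a group with finite torsion `T`: the `p`-primary component is the
`p`-part of the torsion subgroup. [folklore] -/
theorem pow_padicValNat_natCard_torsion [Finite (AddCommGroup.torsion A)] :
    p ^ padicValNat p (Nat.card (AddCommGroup.torsion A)) =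
      Nat.card (AddCommGroup.primaryComponent A p) := by
  rw [← LocalIndex.natCard_primaryComponent_torsion A p,
    Literature.NumberTheory.EllipticCurves.card_addPrimaryComponent_eq_pow,
    Nat.factorization_def _ (Fact.out : p.Prime)]

include hQ hker in
/-- **`ord_p [A : ℤP] = ord_p |c P| + ord_p #T`** (`= ord_p |c P| + log_p #A[p^∞]`); the torsion-free
case is `RankOne.padicValNat_index_zmultiples_eq`.
[cite: JetchevSkinnerWan2017, Prop. 3.2.1 and (7.1.5) (arXiv:1512.06894 pp. 10, 16), the index `[E(K):ℤP]_p`] -/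
theorem padicValNat_index_zmultiples_eq_add [Finite (AddCommGroup.torsion A)] (P : A) (hP : c P ≠ 0) :
    padicValNat p (AddSubgroup.zmultiples P).index =
      padicValNat p (c P).natAbs + padicValNat p (Nat.card (AddCommGroup.torsion A)) := by
  rw [index_zmultiples_eq_natAbs_mul_natCard_torsion c Q hQ hker P hP,
    padicValNat.mul (Int.natAbs_ne_zero.mpr hP) Nat.card_pos.ne']

end Global

end Summit.BirchSwinnertonDyer.BirchSwinnertonDyer.Theorems.SchneiderFreeAdditiveX3

end
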